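import Mathlib
import Literature.AlgebraicGeometry.Resolution.PowerSeriesRegularLocal
import Literature.AlgebraicGeometry.Resolution.AdicNoetherian
import Summits.HodgeConjecture.HodgeConjecture.Theorems.HodgeLocusCensusEmbDimOne
import HarnessLib
import HarnessLib.Audit.Tags

/-!
# HodgeLocusCensusFMExactCore — one equation on a smooth 2-germ, sitting inside a germ of
embedding dimension one, forces that germ to be the smooth curve

HONEST FRAMING (verbatim, pub-hlocus cell): certified instances and evidence bearing on the general
Hodge conjecture; no claim.

This is the commutative-algebra skeleton of steps (ii) + (iii) of the referee-ruled 'F_M EXACT'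
theorem of the (8,3,1) slice-germ census (cell files `pub-hlocus-ivhs-2/FMEXACT-g14.md` §2,
`REFEREE.md` R74(a), `CENSUS-SUMMARY.md` §2 row O8), continuing
`HodgeLocusCensusEmbDimOne.lean` (step (iii) alone).

DICTIONARY (what is and is not formalised).
* The slice germ `(V_λ ∩ (F+Λ), X_F)` of a curve row has embedding dimension `e = 1` (a finite,
  two-kernel computation of the cell, NOT formalised), so by Cohen's structure theorem (NOT
  formalised) its complete local ring is `K⟦u⟧ ⧸ I` for an ideal `I` of the formal power series
  ring in one variable (`K = ℂ`; we work over any field `K`, with `K⟦X⟧` the formal proxy of the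
  analytic DVR `ℂ{u}`).
* Step (ii) of R74(a): the cone-family trace `Λ'_M = (F+Λ) ∩ (F+T_F M)` is a smooth germ of
  dimension `2` (a two-implementation rank computation, NOT formalised) — complete local ring
  `K⟦a,b⟧ = MvPowerSeries (Fin 2) K` — and on it the Hodge locus of the flat transport of `λ` is
  cut out by ONE holomorphic equation `f` with `f(0) = 0` (one period, `h^{3,1} = 1` for cubic
  fourfolds; Hodge theory, NOT formalised).  Its zero locus `W` therefore has complete local ring
  `K⟦a,b⟧ ⧸ (f)`.
* `W ⊆ V_λ ∩ (F+Λ)` as closed sub-germs of `(F+Λ, X_F)` (step (ii), NOT formalised) is, on complete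
  local rings, a SURJECTION `ψ : K⟦u⟧ ⧸ I →+* K⟦a,b⟧ ⧸ (f)`.
* CONCLUSION formalised here (`fmExactCore`): then `I = ⊥`, i.e. the slice germ IS the smooth curve
  germ `Spec K⟦u⟧` — which is step (iii) ('positive-dimensional sub-germ of an e = 1 germ forces
  equality'); the identification of that curve with `F_M(λ) ∩ (F+Λ)` and the algebraicity of `δ_λ`
  along it (Zucker 1977, step (iv)) are Hodge theory and are NOT formalised.

What the kernel checks:
* `exists_prime_ne_maximal_of_mem_maximalIdeal` — in `K⟦a,b⟧` the zero locus of one equation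
  `f ∈ 𝔪` has positive dimension: some prime `P ∋ f` is not the closed point (Krull's
  Hauptidealsatz `height ≤ 1` for a minimal prime over `(f)`, Mathlib, against
  `dim K⟦a,b⟧ = 2`, the tree's `Literature.AlgebraicGeometry.Resolution.ringKrullDim_mvPowerSeries`
  [cite: Matsumura1987, §19]).
* `exists_prime_ne_maximal_quotient_span` — the same in the quotient `K⟦a,b⟧ ⧸ (f)`: it is not a
  zero-dimensional local ring.
* `comap_ne_maximalIdeal_of_surjective` — under a surjection of rings, the pull-back of a
  non-maximal prime is non-maximal (closed immersions do not shrink dimension of the image germ).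
* `fmExactCore` — the assembled statement: `I = ⊥`.
* `fmExactCore_not_fatPoint` — contrapositive census reading: a FAT-POINT row (`I = (uⁿ)`, `n ≥ 1`)
  contains no such `W`; in particular no cone-family curve passes through `X_F` inside the slice of a
  fat-point row (consistent with the 226 fat-point rows of row O8 being NONREDUCED-along-NL(pair)
  certificates and the 60 curve rows being exactly the F_M(λ) rows).

No definitions are introduced. Mathlib inputs: `Ideal.exists_minimalPrimes_le`,
`Ideal.height_le_one_of_isPrincipal_of_mem_minimalPrimes` (Krull), 
`IsLocalRing.maximalIdeal_height_eq_ringKrullDim`, `Ideal.map_eq_top_or_isMaximal_of_surjective`,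
`Ideal.map_comap_of_surjective`; tree inputs: `ringKrullDim_mvPowerSeries`,
`isNoetherianRing_mvPowerSeries` (Literature/AlgebraicGeometry/Resolution), and
`ideal_eq_bot_of_le_prime_ne_maximal`, `fatPoint_primes_eq_maximal` of `HodgeLocusCensusEmbDimOne`.
-/

namespace Summit.HodgeConjecture.HodgeConjecture.HodgeLocus.Census

open PowerSeries IsLocalRing

universe u

variable {K : Type u} [Field K]

/-- STEP (ii'), dimension count: in the smooth two-dimensional germ `K⟦a,b⟧` the zero locus of ONE
equation `f` with `f(0) = 0` has positive dimension — some prime ideal containing `f` is not the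
maximal ideal.  (A minimal prime over `(f)` has height `≤ 1` by Krull's principal ideal theorem,
while the maximal ideal has height `dim K⟦a,b⟧ = 2`.) -/
theorem exists_prime_ne_maximal_of_mem_maximalIdeal (f : MvPowerSeries (Fin 2) K)
    (hf : f ∈ maximalIdeal (MvPowerSeries (Fin 2) K)) :
    ∃ P : Ideal (MvPowerSeries (Fin 2) K), P.IsPrime ∧ f ∈ P ∧
      P ≠ maximalIdeal (MvPowerSeries (Fin 2) K) := by
  haveI : IsNoetherianRing (MvPowerSeries (Fin 2) K) :=
    Literature.AlgebraicGeometry.Resolution.isNoetherianRing_mvPowerSeries K (Fin 2)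
  have hle : Ideal.span {f} ≤ maximalIdeal (MvPowerSeries (Fin 2) K) := by
    rw [Ideal.span_le, Set.singleton_subset_iff]
    exact hf
  obtain ⟨p, hp, -⟩ := Ideal.exists_minimalPrimes_le hle
  haveI hpP : p.IsPrime := hp.1.1
  refine ⟨p, hpP, hp.1.2 (Ideal.mem_span_singleton_self f), ?_⟩
  intro hpeq
  have h1 : p.height ≤ 1 :=
    Ideal.height_le_one_of_isPrincipal_of_mem_minimalPrimes (Ideal.span {f}) p hp
  have h2 := IsLocalRing.maximalIdeal_height_eq_ringKrullDim (R := MvPowerSeries (Fin 2) K)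
  rw [Literature.AlgebraicGeometry.Resolution.ringKrullDim_mvPowerSeries K (Fin 2),
    ← WithBot.coe_natCast] at h2
  have h3 : (maximalIdeal (MvPowerSeries (Fin 2) K)).height = (Nat.card (Fin 2) : ℕ∞) :=
    WithBot.coe_injective h2
  rw [Nat.card_eq_fintype_card, Fintype.card_fin, ← hpeq] at h3
  rw [h3] at h1
  have h4 : ¬ (((2 : ℕ) : ℕ∞) ≤ 1) := by
    decide
  exact h4 h1

/-- The same, read in the quotient: `K⟦a,b⟧ ⧸ (f)` (`f ∈ 𝔪`) has a prime ideal which is not maximal —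
the hypersurface germ `W = {f = 0}` is not a point (not even a fat one). -/
theorem exists_prime_ne_maximal_quotient_span (f : MvPowerSeries (Fin 2) K)
    (hf : f ∈ maximalIdeal (MvPowerSeries (Fin 2) K)) :
    ∃ Q : Ideal (MvPowerSeries (Fin 2) K ⧸ Ideal.span {f}), Q.IsPrime ∧ ¬ Q.IsMaximal := by
  obtain ⟨P, hP, hfP, hne⟩ := exists_prime_ne_maximal_of_mem_maximalIdeal f hf
  have hker : Ideal.span {f} ≤ P := by
    rw [Ideal.span_le, Set.singleton_subset_iff]; exact hfP
  haveI := hP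
  refine ⟨P.map (Ideal.Quotient.mk (Ideal.span {f})), ?_, ?_⟩
  · exact Ideal.map_isPrime_of_surjective Ideal.Quotient.mk_surjective (by simpa using hker)
  · intro hmax
    apply hne
    -- pull back: comap (map P) = P (P ⊇ ker), and comap of a maximal ideal along a surjection is maximal
    have hcomap : (P.map (Ideal.Quotient.mk (Ideal.span {f}))).comap (Ideal.Quotient.mk (Ideal.span {f})) = P := by
      rw [Ideal.comap_map_of_surjective _ Ideal.Quotient.mk_surjective, ← RingHom.ker_eq_comap_bot,
        Ideal.mk_ker]
      exact sup_eq_left.mpr hker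
    have hPmax : P.IsMaximal := by
      rw [← hcomap]; exact Ideal.comap_isMaximal_of_surjective _ Ideal.Quotient.mk_surjective
    exact IsLocalRing.eq_maximalIdeal hPmax

/-- Closed immersions do not lower dimension of what they contain: under a SURJECTIVE ring map
`ψ : A →+* B`, the pull-back of a prime of `B` which is not maximal is a prime of `A` which is not
maximal. -/
theorem comap_not_isMaximal_of_surjective {A B : Type*} [CommRing A] [CommRing B] (ψ : A →+* B)
    (hψ : Function.Surjective ψ) {Q : Ideal B} (hQ : Q.IsPrime) (hQm : ¬ Q.IsMaximal) :
    (Q.comap ψ).IsPrime ∧ ¬ (Q.comap ψ).IsMaximal := by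
  refine ⟨Ideal.comap_isPrime ψ Q, ?_⟩
  intro hmax
  rcases Ideal.map_eq_top_or_isMaximal_of_surjective ψ hψ hmax with htop | hm
  · rw [Ideal.map_comap_of_surjective ψ hψ] at htop
    exact hQ.ne_top htop
  · rw [Ideal.map_comap_of_surjective ψ hψ] at hm
    exact hQm hm

/-- **F_M EXACT, commutative-algebra core (R74(a) steps (ii)+(iii)).**  Let the slice germ have
embedding dimension one, complete local ring `K⟦u⟧ ⧸ I`.  If it contains, as a closed sub-germ, the
zero locus `W` of ONE equation `f` with `f(0) = 0` on a smooth two-dimensional germ — i.e. there is a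
surjection `ψ : K⟦u⟧ ⧸ I →+* K⟦a,b⟧ ⧸ (f)` — then `I = ⊥`: the slice germ is the smooth curve germ
itself (and `W`, being a positive-dimensional closed sub-germ of a smooth curve germ, is all of it).
No transversality hypothesis `df(0) ≠ 0` is needed, as the referee observed. -/
theorem fmExactCore (I : Ideal K⟦X⟧) (f : MvPowerSeries (Fin 2) K)
    (hf : f ∈ maximalIdeal (MvPowerSeries (Fin 2) K))
    (ψ : (K⟦X⟧ ⧸ I) →+* (MvPowerSeries (Fin 2) K ⧸ Ideal.span {f}))
    (hψ : Function.Surjective ψ) : I = ⊥ := by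
  obtain ⟨Q, hQ, hQm⟩ := exists_prime_ne_maximal_quotient_span f hf
  -- pull Q back to K⟦u⟧ ⧸ I, then to K⟦u⟧
  obtain ⟨hQ', hQ'm⟩ := comap_not_isMaximal_of_surjective ψ hψ hQ hQm
  obtain ⟨hP, hPm⟩ := comap_not_isMaximal_of_surjective (Ideal.Quotient.mk I)
    Ideal.Quotient.mk_surjective hQ' hQ'm
  set P : Ideal K⟦X⟧ := (Q.comap ψ).comap (Ideal.Quotient.mk I) with hPdef
  have hIP : I ≤ P := by
    intro x hx
    simp only [hPdef, Ideal.mem_comap]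
    have : (Ideal.Quotient.mk I x) = 0 := Ideal.Quotient.eq_zero_iff_mem.mpr hx
    rw [this, map_zero]
    exact Q.zero_mem
  have hne : P ≠ maximalIdeal K⟦X⟧ := by
    intro h
    exact hPm (h ▸ IsLocalRing.maximalIdeal.isMaximal K⟦X⟧)
  exact ideal_eq_bot_of_le_prime_ne_maximal hP hne hIP

/-- Census reading (contrapositive): the slice germ of a FAT-POINT row, complete local ring
`K⟦u⟧ ⧸ (uⁿ)` with `n ≥ 1`, contains NO zero locus of one equation on a smooth 2-germ as a closed
sub-germ — in the dictionary: no cone-family curve (indeed no curve at all) passes through `X_F`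
inside the slice of a fat-point row. -/
theorem fmExactCore_not_fatPoint (n : ℕ) (hn : 1 ≤ n) (f : MvPowerSeries (Fin 2) K)
    (hf : f ∈ maximalIdeal (MvPowerSeries (Fin 2) K))
    (ψ : (K⟦X⟧ ⧸ Ideal.span {(X : K⟦X⟧) ^ n}) →+* (MvPowerSeries (Fin 2) K ⧸ Ideal.span {f})) :
    ¬ Function.Surjective ψ := by
  intro hψ
  have h := fmExactCore (Ideal.span {(X : K⟦X⟧) ^ n}) f hf ψ hψ
  exact (span_X_pow_ne_bot_ne_top (K := K) n hn).1 h


end Summit.HodgeConjecture.HodgeConjecture.HodgeLocus.Census
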